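import Literature.AnabelianGeometry.EtaleTheta.Discharge.Sec5Thm57TorsionOfKummerCocycle
import Literature.AnabelianGeometry.EtaleTheta.Discharge.Sec5Thm57EtaleTorsionOfRigidityTower

/-!
# [EtTh] §5, Theorem 5.7, the (C)-chain KNIT: `c^{2l} = 1` (and Thm. 5.7 at all levels, anchored form) from constant-multiple
# rigidity on the tower of §2 data — ONE entry point for the composer (pp. 329–331, 291, 268 / PDF pp. 103–105, 65, 42)

Mochizuki, *The étale theta function and its Frobenioid-theoretic manifestations*, Publ. RIMS **45** (2009)
[cite: MochizukiEtTh2009, Thm 5.7 proof p.330 (PDF p.104); Cor 2.19 (iii) p.291 (PDF p.65); Cor 2.8 (i) p.268 (PDF p.42);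
Lem 5.8 p.331 (PDF p.105); Rmk 4.3.2 p.318–319 (PDF pp.92–93); Prop 3.2 (iii) p.296 (PDF p.70)].
Seat abc-iut-w6-d049 (gen 5; node `EtTh:Thm5.7`, abc-iut-L2-lead (gen 5) R633 «R535 (b) — the (tor) content»), third file of the row:
the COMPOSITION of `Sec5Thm57TorsionOfKummerCocycle.lean` (p473372: Frobenioid side, `c^{2l} = 1` from the torsion of the Kummer
cocycles of the discrepancies on a cofinal set of levels; étale torsion ⟹ Frobenioid torsion through abc-iut-L2-t4's
`CyclotomicCharacterCompat`) with `Sec5Thm57EtaleTorsionOfRigidityTower.lean` (p476411: the étale torsion clause at every level of a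
`ThetaEnvTower` from the conclusion SHAPE of abc-iut-L2-t2's FACT `MuTwoSetting.Cor219_iii_std`, F-0652).  PROOF-ONLY (0 definitions,
nothing landed is edited or restated).

RESULT.
* `ThetaFrobenioidTower.pow_two_l_eq_one_of_cor219iiiStd` : `c^{2l} = 1` for the constant `c` of the coherent family's discrepancies
  (`w_N^N = c`, `hpow`), from — Frobenioid side: `hK` (`⋂_N (K^×)^N = 1`), Lemma 5.8 at every level (`hgc`), the factorisation `hfac` and
  Prop. 4.3 (iii) (`hdiff`) at the levels `N ∈ E`; dictionary per level `M ∈ E`: `(𝒯.level M, ι, m_M)` with `IdentifiesPiYdd`,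
  `CyclotomicCharacterCompat`, and the cocycle `κ_M` of `hC5` whose transport through `m_M` is the Kummer cocycle of `w_M` (`hκ`, the
  HC-tautology shape of abc-iut-L2-d3's J-L2d3-1 (1)); étale side on the tower `𝒯`: `(γ, γ_μ)` with `hstd` = VERBATIM the conclusion of
  `Cor219_iii_std`, the glue `hγμχ`/`hγμred`/`haug` (all three PROVED elsewhere in p476411 from `thetaMod_conj`, the Cor. 2.19 (iii)
  hypothesis shape and Cor. 2.18 (i)), a COMPATIBLE family `η` of members with `hC5`, the inflatedness `hinf` of `κ` (GAP G-L2d3-8's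
  conclusion shape) and the separation ACROSS levels `hsep`.
* `ThetaFrobenioidTower.thetaRootPreservedAll_of_anchoredFamily_of_cor219iiiStd` : [EtTh] Thm. 5.7 (root level) at ALL levels in the
  anchored form of p445072 / p473372, with the (C)-binder supplied by the same étale data.
HONEST FRAMING: kernel-checked composition; none of the displayed binders is proved here or asserted to hold at any model (in particular
F-0652 is a FACT-policy label and `hsep`/`hinf`/`hηc` are named residuals of the cell's ledger); nothing of [EtTh] is asserted
unconditionally; typed ≠ discharged; no side taken on anything downstream ([IUTchIII] Cor. 3.12 in particular).
-/

namespace Literature.AnabelianGeometry.EtaleTheta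

open CategoryTheory
open Literature.AlgebraicGeometry.Frobenioids

universe w v v' u u'

namespace ThetaFrobenioidTower

variable {C : Type u} [Category.{v} C] {D : Type u'} [Category.{v'} D] (𝔗 : ThetaFrobenioidTower.{w} C D)
  (Ψ : C ≌ C) {E : Set ℕ+} (𝒯 : ThetaEnvTower.{v} E)

/-- **`c^{2l} = 1` from constant-multiple rigidity on the tower** — the (C)-chain of Thm. 5.7 knit end to end: p476411's
`etaleTorsion_of_cor219iiiStd` (étale torsion at every level `M ∈ E`) ⟶ p473372's `kummerTorsion_of_etaleTorsion` (Frobenioid torsion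
at level `M`, `n := 2l`) ⟶ p473372's `pow_two_l_eq_one_of_kummerTorsion` (`S := E`, cofinal by `𝒯.cofinal`).  See the module
docstring for the binder census.  [cite: MochizukiEtTh2009, Thm 5.7 proof p.330 (PDF p.104); Cor 2.19 (iii) p.291 (PDF p.65); Lem 5.8 p.331 (PDF p.105)] -/
theorem pow_two_l_eq_one_of_cor219iiiStd
    -- Frobenioid side
    (hK : ∀ x : 𝔗.Kˣ, (∀ N : ℕ+, ∃ d : 𝔗.Kˣ, d ^ (N : ℕ) = x) → x = 1)
    (hdiff : ∀ N ∈ E, (𝔗.atLevel N).BiKummerDifferenceMem)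
    (hfac : ∀ N ∈ E, ∀ y ∈ (𝔗.atLevel N).imPiY, ∃ x ∈ (𝔗.atLevel N).HB, ∀ u ∈ (𝔗.atLevel N).units (𝔗.BN N),
      𝔗.sgpCap N y * u * (𝔗.sgpCap N y)⁻¹ = 𝔗.sgpCap N x * u * (𝔗.sgpCap N x)⁻¹)
    (hgc : ∀ (N : ℕ+) (u : (𝔗.atLevel N).units (𝔗.BN N)),
      (∀ y ∈ (𝔗.atLevel N).imPiY, 𝔗.sgpCap N y * (u : Aut (𝔗.BN N)) * (𝔗.sgpCap N y)⁻¹ = u) →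
        (𝔗.atLevel N).unitsToBirat (𝔗.BN N) u ∈ (𝔗.constEmb N).range)
    {c : 𝔗.Kˣ} (wf : ∀ N : ℕ+, Aut (𝔗.BN N)) (hw : ∀ N : ℕ+, wf N ∈ (𝔗.atLevel N).units (𝔗.BN N))
    (hpow : ∀ N : ℕ+, (𝔗.atLevel N).unitsToBirat (𝔗.BN N) ⟨wf N, hw N⟩ ^ (N : ℕ) = 𝔗.constEmb N c)
    -- the §5 ↔ §2 dictionary at every level `M ∈ E`
    (ι : 𝔗.PiX ≃* 𝒯.PiX)
    (m : ∀ M : E, (𝔗.atLevel M).muTorsion (𝔗.atLevel M).BN (𝔗.atLevel M).N ≃* (𝒯.level M).mu)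
    (hι : ∀ y : 𝔗.PiX, y ∈ 𝔗.PiYdd ↔ ι y ∈ 𝒯.PiYdd)
    (hχ : ∀ M : E, (𝔗.atLevel M).CyclotomicCharacterCompat (𝒯.level M) ι (m M))
    (κ : ∀ M : E, 𝒯.PiYdd → 𝒯.mu M)
    (hκ : ∀ (M : E) (k : 𝔗.PiYdd),
      (((m M).symm (κ M ⟨ι k, (hι k).mp k.2⟩) : (𝔗.atLevel M).muTorsion (𝔗.atLevel M).BN (𝔗.atLevel M).N) :
          Aut (𝔗.atLevel M).BN) =
        𝔗.sgpCup M ((𝔗.atLevel M).rhoYdd k) * wf M * (𝔗.sgpCup M ((𝔗.atLevel M).rhoYdd k))⁻¹ * (wf M)⁻¹)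
    -- étale side on the tower
    (γ : 𝒯.PiX ≃ₜ* 𝒯.PiX) (hγ : 𝒯.PiYdd.map γ.toMulEquiv.toMonoidHom = 𝒯.PiYdd)
    (hγ' : ∀ x : 𝒯.PiX, x ∈ 𝒯.PiYdd → γ x ∈ 𝒯.PiYdd) (γμ : ∀ M : E, 𝒯.mu M ≃* 𝒯.mu M)
    (hstd : ∃ cf : ∀ M : E, 𝒯.G → 𝒯.mu M,
      (∀ M, CycEnvelope.IsEnvCocycle (MonoidHom.id 𝒯.G) (𝒯.chi M) (cf M)) ∧
      (∀ M, IsLocallyConstant (cf M ∘ 𝒯.aug)) ∧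
      (∀ (M M' : E) (h : (M : ℕ+) ∣ M'), 𝒯.red M M' h ∘ cf M' = cf M) ∧
      (∀ M, 𝒯.pullbackCocycle M γ hγ (γμ M) '' 𝒯.thetaCocycles M =
        (fun η => η * (cf M ∘ 𝒯.aug ∘ 𝒯.PiYdd.subtype)) '' 𝒯.thetaCocycles M) ∧
      ∀ M : E, ∃ d : 𝒯.mu M, ∀ g : 𝒯.G, cf M g ^ 𝔗.l = CycEnvelope.coboundary (MonoidHom.id 𝒯.G) (𝒯.chi M) d g)
    (hγμχ : ∀ (M : E) (x : 𝒯.PiX) (t : 𝒯.mu M), γμ M (𝒯.chi M (𝒯.aug x) t) = 𝒯.chi M (𝒯.aug (γ x)) (γμ M t))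
    (hγμred : ∀ (M M' : E) (h : (M : ℕ+) ∣ M') (t : 𝒯.mu M'), 𝒯.red M M' h (γμ M' t) = γμ M (𝒯.red M M' h t))
    (haug : ∀ x y : 𝒯.PiX, 𝒯.aug x = 𝒯.aug y → 𝒯.aug (γ x) = 𝒯.aug (γ y))
    (η : ∀ M : E, 𝒯.PiYdd → 𝒯.mu M) (hη : ∀ M, η M ∈ 𝒯.thetaCocycles M)
    (hηc : ∀ (M M' : E) (h : (M : ℕ+) ∣ M'), 𝒯.red M M' h ∘ η M' = η M)
    (hC5 : ∀ (M : E) (k : 𝒯.PiYdd), γμ M (η M k) = η M ⟨γ k, hγ' k k.2⟩ * κ M ⟨γ k, hγ' k k.2⟩)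
    (hinf : ∀ (M : E) (k k' : 𝒯.PiYdd), 𝒯.aug k = 𝒯.aug k' → κ M k = κ M k')
    (hsep : ∀ η' : ∀ M : E, 𝒯.PiYdd → 𝒯.mu M, (∀ M, η' M ∈ 𝒯.thetaCocycles M) →
      (∀ (M M' : E) (h : (M : ℕ+) ∣ M'), 𝒯.red M M' h ∘ η' M' = η' M) →
      (∀ (M : E) (k k' : 𝒯.PiYdd), 𝒯.aug k = 𝒯.aug k' → η' M k * (η M k)⁻¹ = η' M k' * (η M k')⁻¹) →
      ∀ M : E, ∃ d : 𝒯.mu M, ∀ k : 𝒯.PiYdd,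
        (η' M k * (η M k)⁻¹) ^ 2 = CycEnvelope.coboundary (𝒯.aug.comp 𝒯.PiYdd.subtype) (𝒯.chi M) d k) :
    c ^ (2 * 𝔗.l) = 1 :=
  𝔗.pow_two_l_eq_one_of_kummerTorsion hK 𝒯.cofinal hdiff hfac hgc wf hw hpow fun N hN =>
    ThetaFrobenioid.kummerTorsion_of_etaleTorsion (𝔉 := 𝔗.atLevel N) (𝒯.level ⟨N, hN⟩) ι (m ⟨N, hN⟩) hι
      (hχ ⟨N, hN⟩) (hdiff N hN) (hw N) (κ ⟨N, hN⟩) (hκ ⟨N, hN⟩) (2 * 𝔗.l)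
      (𝒯.etaleTorsion_of_cor219iiiStd γ hγ hγ' γμ hstd hγμχ hγμred haug η hη hηc κ hC5 hinf hsep ⟨N, hN⟩)

/-- **[EtTh] Theorem 5.7 (root level) at ALL levels, anchored form, with the (C)-binder supplied by constant-multiple rigidity on
the tower** — p473372's `thetaRootPreservedAll_of_anchoredFamily_of_kummerTorsion` with `htors` DISCHARGED by p476411's étale theorem
through the per-level dictionary; the remaining displayed inputs are structural / §4 / anchor binders VERBATIM p445072, the dictionary,
and the étale data (`hstd` = F-0652 shape, glue, compatible `η`, `hC5`, `hinf`, `hsep`).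
[cite: MochizukiEtTh2009, Thm 5.7 p.329–330 (PDF pp.103–104); Cor 2.19 (iii) p.291 (PDF p.65); Rmk 4.3.2 p.318–319 (PDF pp.92–93); Lem 5.8 p.331 (PDF p.105)] -/
theorem thetaRootPreservedAll_of_anchoredFamily_of_cor219iiiStd (hepi : ∀ ⦃X Y : C⦄ (f : X ⟶ Y), Epi f)
    (hconst : ∀ (N : ℕ+) (u : Aut (𝔗.BN N)) (hu : u ∈ (𝔗.atLevel N).units (𝔗.BN N)) (u₁ : Aut (𝔗.BN 1))
      (hu₁ : u₁ ∈ (𝔗.atLevel 1).units (𝔗.BN 1)) (c : 𝔗.Kˣ),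
      u.hom ≫ 𝔗.β (one_dvd_level N) = 𝔗.β (one_dvd_level N) ≫ u₁.hom →
      (𝔗.atLevel 1).unitsToBirat (𝔗.BN 1) ⟨u₁, hu₁⟩ = 𝔗.constEmb 1 c →
        (𝔗.atLevel N).unitsToBirat (𝔗.BN N) ⟨u, hu⟩ ^ (N : ℕ) = 𝔗.constEmb N c)
    (hcap₁ : (𝔗.atLevel 1).SgpCapSpec) (hcup₁ : (𝔗.atLevel 1).SgpCupSpec)
    (hdiff₁ : (𝔗.atLevel 1).BiKummerDifferenceMem) (h58₁ : (𝔗.atLevel 1).ConstantsActByCyclotome)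
    (hfac₁ : ∀ y ∈ (𝔗.atLevel 1).imPiY, ∃ h ∈ (𝔗.atLevel 1).HB, ∀ u ∈ (𝔗.atLevel 1).units (𝔗.BN 1),
      𝔗.sgpCap 1 y * u * (𝔗.sgpCap 1 y)⁻¹ = 𝔗.sgpCap 1 h * u * (𝔗.sgpCap 1 h)⁻¹)
    (hK : ∀ x : 𝔗.Kˣ, (∀ N : ℕ+, ∃ d : 𝔗.Kˣ, d ^ (N : ℕ) = x) → x = 1)
    (hgc : ∀ (N : ℕ+) (u : (𝔗.atLevel N).units (𝔗.BN N)),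
      (∀ y ∈ (𝔗.atLevel N).imPiY, 𝔗.sgpCap N y * (u : Aut (𝔗.BN N)) * (𝔗.sgpCap N y)⁻¹ = u) →
        (𝔗.atLevel N).unitsToBirat (𝔗.BN N) u ∈ (𝔗.constEmb N).range)
    (hdiff : ∀ N ∈ E, (𝔗.atLevel N).BiKummerDifferenceMem)
    (hfac : ∀ N ∈ E, ∀ y ∈ (𝔗.atLevel N).imPiY, ∃ x ∈ (𝔗.atLevel N).HB, ∀ u ∈ (𝔗.atLevel N).units (𝔗.BN N),
      𝔗.sgpCap N y * u * (𝔗.sgpCap N y)⁻¹ = 𝔗.sgpCap N x * u * (𝔗.sgpCap N x)⁻¹)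
    -- the normalised ANCHOR at the first root
    {α₁ : Ψ.functor.obj (𝔗.AN 1) ≅ 𝔗.AN 1} {β₁ : Ψ.functor.obj (𝔗.BN 1) ≅ 𝔗.BN 1} {u₁ : Aut (𝔗.BN 1)}
    (hT₁ : α₁.inv ≫ Ψ.functor.map (𝔗.sCap 1) ≫ β₁.hom = 𝔗.sCap 1)
    (hT₁' : α₁.inv ≫ Ψ.functor.map (𝔗.sCup 1) ≫ β₁.hom = 𝔗.sCup 1 ≫ u₁.hom)
    (hu₁ : u₁ ∈ (𝔗.atLevel 1).units (𝔗.BN 1))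
    (hU₁ : ((𝔗.atLevel 1).units (𝔗.BN 1)).map ((𝔗.atLevel 1).psiAut Ψ β₁) = (𝔗.atLevel 1).units (𝔗.BN 1))
    (θ₁ : Aut (𝔗.pre.base.obj (𝔗.BN 1)) ≃* Aut (𝔗.pre.base.obj (𝔗.BN 1)))
    (hstrv₁ : (𝔗.atLevel 1).StrvTransport Ψ α₁ (Iso.refl _) θ₁)
    (hYdd₁ : (𝔗.atLevel 1).HB.map θ₁.toMonoidHom = (𝔗.atLevel 1).HB)
    -- the family, coherent with the anchor
    (a : ∀ N : ℕ+, Ψ.functor.obj (𝔗.AN N) ≅ 𝔗.AN N) (b : ∀ N : ℕ+, Ψ.functor.obj (𝔗.BN N) ≅ 𝔗.BN N)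
    (w : ∀ N : ℕ+, Aut (𝔗.BN N))
    (hw : ∀ N : ℕ+, w N ∈ (𝔗.atLevel N).units (𝔗.BN N))
    (hT : ∀ N : ℕ+, (a N).inv ≫ Ψ.functor.map (𝔗.sCap N) ≫ (b N).hom = 𝔗.sCap N)
    (hT' : ∀ N : ℕ+, (a N).inv ≫ Ψ.functor.map (𝔗.sCup N) ≫ (b N).hom = 𝔗.sCup N ≫ (w N).hom)
    (hΨα : ∀ N : ℕ+,
      (a N).inv ≫ Ψ.functor.map (𝔗.α (one_dvd_level N)) ≫ α₁.hom = 𝔗.α (one_dvd_level N))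
    (hΨβ : ∀ N : ℕ+,
      (b N).inv ≫ Ψ.functor.map (𝔗.β (one_dvd_level N)) ≫ β₁.hom = 𝔗.β (one_dvd_level N))
    -- the §5 ↔ §2 dictionary at every level `M ∈ E`, with the cocycle of `hC5` read on `w_M`
    (ι : 𝔗.PiX ≃* 𝒯.PiX)
    (m : ∀ M : E, (𝔗.atLevel M).muTorsion (𝔗.atLevel M).BN (𝔗.atLevel M).N ≃* (𝒯.level M).mu)
    (hι : ∀ y : 𝔗.PiX, y ∈ 𝔗.PiYdd ↔ ι y ∈ 𝒯.PiYdd)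
    (hχ : ∀ M : E, (𝔗.atLevel M).CyclotomicCharacterCompat (𝒯.level M) ι (m M))
    (κ : ∀ M : E, 𝒯.PiYdd → 𝒯.mu M)
    (hκ : ∀ (M : E) (k : 𝔗.PiYdd),
      (((m M).symm (κ M ⟨ι k, (hι k).mp k.2⟩) : (𝔗.atLevel M).muTorsion (𝔗.atLevel M).BN (𝔗.atLevel M).N) :
          Aut (𝔗.atLevel M).BN) =
        𝔗.sgpCup M ((𝔗.atLevel M).rhoYdd k) * w M * (𝔗.sgpCup M ((𝔗.atLevel M).rhoYdd k))⁻¹ * (w M)⁻¹)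
    -- étale side on the tower
    (γ : 𝒯.PiX ≃ₜ* 𝒯.PiX) (hγ : 𝒯.PiYdd.map γ.toMulEquiv.toMonoidHom = 𝒯.PiYdd)
    (hγ' : ∀ x : 𝒯.PiX, x ∈ 𝒯.PiYdd → γ x ∈ 𝒯.PiYdd) (γμ : ∀ M : E, 𝒯.mu M ≃* 𝒯.mu M)
    (hstd : ∃ cf : ∀ M : E, 𝒯.G → 𝒯.mu M,
      (∀ M, CycEnvelope.IsEnvCocycle (MonoidHom.id 𝒯.G) (𝒯.chi M) (cf M)) ∧
      (∀ M, IsLocallyConstant (cf M ∘ 𝒯.aug)) ∧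
      (∀ (M M' : E) (h : (M : ℕ+) ∣ M'), 𝒯.red M M' h ∘ cf M' = cf M) ∧
      (∀ M, 𝒯.pullbackCocycle M γ hγ (γμ M) '' 𝒯.thetaCocycles M =
        (fun η => η * (cf M ∘ 𝒯.aug ∘ 𝒯.PiYdd.subtype)) '' 𝒯.thetaCocycles M) ∧
      ∀ M : E, ∃ d : 𝒯.mu M, ∀ g : 𝒯.G, cf M g ^ 𝔗.l = CycEnvelope.coboundary (MonoidHom.id 𝒯.G) (𝒯.chi M) d g)
    (hγμχ : ∀ (M : E) (x : 𝒯.PiX) (t : 𝒯.mu M), γμ M (𝒯.chi M (𝒯.aug x) t) = 𝒯.chi M (𝒯.aug (γ x)) (γμ M t))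
    (hγμred : ∀ (M M' : E) (h : (M : ℕ+) ∣ M') (t : 𝒯.mu M'), 𝒯.red M M' h (γμ M' t) = γμ M (𝒯.red M M' h t))
    (haug : ∀ x y : 𝒯.PiX, 𝒯.aug x = 𝒯.aug y → 𝒯.aug (γ x) = 𝒯.aug (γ y))
    (η : ∀ M : E, 𝒯.PiYdd → 𝒯.mu M) (hη : ∀ M, η M ∈ 𝒯.thetaCocycles M)
    (hηc : ∀ (M M' : E) (h : (M : ℕ+) ∣ M'), 𝒯.red M M' h ∘ η M' = η M)
    (hC5 : ∀ (M : E) (k : 𝒯.PiYdd), γμ M (η M k) = η M ⟨γ k, hγ' k k.2⟩ * κ M ⟨γ k, hγ' k k.2⟩)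
    (hinf : ∀ (M : E) (k k' : 𝒯.PiYdd), 𝒯.aug k = 𝒯.aug k' → κ M k = κ M k')
    (hsep : ∀ η' : ∀ M : E, 𝒯.PiYdd → 𝒯.mu M, (∀ M, η' M ∈ 𝒯.thetaCocycles M) →
      (∀ (M M' : E) (h : (M : ℕ+) ∣ M'), 𝒯.red M M' h ∘ η' M' = η' M) →
      (∀ (M : E) (k k' : 𝒯.PiYdd), 𝒯.aug k = 𝒯.aug k' → η' M k * (η M k)⁻¹ = η' M k' * (η M k')⁻¹) →
      ∀ M : E, ∃ d : 𝒯.mu M, ∀ k : 𝒯.PiYdd,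
        (η' M k * (η M k)⁻¹) ^ 2 = CycEnvelope.coboundary (𝒯.aug.comp 𝒯.PiYdd.subtype) (𝒯.chi M) d k) :
    𝔗.ThetaRootPreservedAll Ψ :=
  𝔗.thetaRootPreservedAll_of_anchoredFamily_of_kummerTorsion Ψ hepi hconst hcap₁ hcup₁ hdiff₁ h58₁ hfac₁ hK hgc 𝒯.cofinal hdiff
    hfac hT₁ hT₁' hu₁ hU₁ θ₁ hstrv₁ hYdd₁ a b w hw hT hT' hΨα hΨβ fun N hN =>
      ThetaFrobenioid.kummerTorsion_of_etaleTorsion (𝔉 := 𝔗.atLevel N) (𝒯.level ⟨N, hN⟩) ι (m ⟨N, hN⟩) hι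
        (hχ ⟨N, hN⟩) (hdiff N hN) (hw N) (κ ⟨N, hN⟩) (hκ ⟨N, hN⟩) (2 * 𝔗.l)
        (𝒯.etaleTorsion_of_cor219iiiStd γ hγ hγ' γμ hstd hγμχ hγμred haug η hη hηc κ hC5 hinf hsep ⟨N, hN⟩)

end ThetaFrobenioidTower

end Literature.AnabelianGeometry.EtaleTheta
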